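import Summits.ABC.IUTFork.Joshi.WittPrimitiveElementsStandardPoint
import Mathlib.RingTheory.LocalRing.MaximalIdeal.Basic
import HarnessLib

/-!
# [J-IIp] §6.2 with Joshi's `𝔪_F` LITERALLY: `𝒪_{ℂ_F}` and its tilt `𝒪_{ℂ_F}♭` are local rings (theorems, no instances), `p♭ ∈ 𝔪_F`,
# and over any LOCAL ring of characteristic `p` a primitive element of degree one divisible by `[t] − p` (`t ∈ 𝔪`) GENERATES
# `([t] − p)` — so the ideals `𝔭 = ([a] − p)`, `a ∈ 𝔪 ∖ {0}`, are pairwise INCOMPARABLE and the tuple of Lemma 6.2.2 is unique up to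
# units (proof-only sequel of `Joshi/WittPrimitiveElementsStandardPoint.lean`, block E, seat abc-iut-E-t62)

Proof-only companion (abc-iut cell, block E «type Joshi's construction, test vs S», rung LADDER-ABC:A2.E; seat abc-iut-E-t62, §4-fallback
«DERIVABLE rows of one's own landed files») of `Joshi/WittPrimitiveElements.lean` (p434913) and `Joshi/WittPrimitiveElementsStandardPoint.lean`
(p442499), typing K. Joshi, *Construction of Arithmetic Teichmüller Spaces II: Proof of a local prototype of Mochizuki's Corollary 3.12*,
arXiv:2303.01662v3 = [J-IIp] (`paper:arxiv-2303.01662`; render `HOME/lit/renders/Joshi-arxiv-2303.01662/pNNNN.txt`, «p. N l. M»).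

WHY. p434913 typed §6.2 with Joshi's `𝔪_F` (p. 14 l. 53 «`a ∈ 𝔪_F`», Def. 6.2.3 p. 15 l. 33 «`a ∈ 𝔪_F − {0}`»; `𝔪_F` = the maximal ideal of
the valuation ring `𝒪_F`, `F = ℂ_p♭`) as an ideal PARAMETER `𝔪`, and p442499 discharged Prop. 6.2.1 (2) / Lemma 6.2.2 at the standard
point for «every `𝔪 ∋ p♭`». Here the parameter is pinned to print: (§1) over any LOCAL ring `k` of characteristic `p` with maximal
ideal `𝔪`, **if `[t] − p` (`t ∈ 𝔪`) divides an element `x ∈ 𝕎(k)` whose first Witt coordinate is a unit — e.g. any primitive element of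
degree one, any `[s] − p` — then `(x) = ([t] − p)`** (`span_eq_span_teichSubP_of_dvd`: `x = ([t] − p)·w` has
`x₁ = (−1)^p w₀^p + w₁ t^p` with `w₁ t^p ∈ 𝔪`, so `w₀`, hence `w`, is a unit); consequences: the principal ideals `([s] − p) ⊆ ([t] − p)`
are EQUAL (`span_teichSubP_eq_of_le`) and then `s = t·u` (`exists_unit_of_span_teichSubP_le`), so Prop. 6.2.1 (2)'s ideals
`𝔭_j(a)`, and all `([a] − p)`, `a ∈ 𝔪 ∖ {0}`, are pairwise incomparable (`jIdeal_le_iff`), and the `𝔭_1` of Lemma 6.2.2 (p. 15 l. 15–26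
«there is a tuple … with `𝔭 = 𝔭_1`») is UNIQUE: two parameters `a, b ∈ 𝔪` with `([a] − p) ∣ x` and `([b] − p) ∣ x` give the same ideal
and are associated (`span_teichSubP_eq_of_dvd_of_dvd`). (§2) `PreTilt O p` is a local ring whenever `𝒪` is (`isLocalRing_preTilt`, via
«unit ⟺ image in `𝒪/p` a unit», `preTilt_isUnit_iff`), `𝒪_{ℂ_F} = integerC F` is a local ring (`isLocalRing_integerC`: `‖a‖ = 1` ⟹ unit,
`‖a‖ < 1` ⟹ `‖1 − a‖ = 1`), hence **`𝒪_{ℂ_F}♭` is local and `p♭` lies in its maximal ideal = Joshi's `𝔪_F`** (`pFlat_mem_of_isMaximal`),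
so p442499's standard-point discharges hold for `𝔪 = 𝔪_F` itself (`isPrimitiveDegOne_xi_of_isMaximal`, `ansatzTuple_pFlat_mem_of_isMaximal`)
and §1 applies to `𝕎(𝒪_{ℂ_F}♭)` (`span_eq_jIdeal_pFlat_zero_of_dvd`). Local-ring structure enters ONLY as theorems used through
`haveI` (no `instance`, typer lint). No new `def … : Prop`, no notation, no FACT-LIST input, no `Cor312*`/`Thm311*` import; nothing
bears on S. TYPED AS A CANDIDATE (D-0012): typed ≠ proved ≠ endorsed; **no side is taken** on [IUTchIII] Cor. 3.12, on Joshi's claims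
or on Mochizuki's report on them. [claim: Joshi2023ATS2Local, status: disputed]
-/

noncomputable section

namespace Summit.ABC.IUTFork.Joshi.Witt

open WittVector IsLocalRing

/-! ## 1. Over a local ring of characteristic `p`: divisibility by `[t] − p` among elements with unit first coordinate is equality -/

section LocalCharP

variable (p : ℕ) [hp : Fact p.Prime] {k : Type*} [CommRing k] [CharP k p] [IsLocalRing k]

/-- **If `([t] − p)·w` has unit first Witt coordinate and `t ∈ 𝔪` then `w` is a unit** (`(([t] − p)·w)₁ = (−1)^p w₀^p + w₁ t^p`,
`w₁ t^p ∈ 𝔪`, so `(−1)^p w₀^p ∉ 𝔪`; a Witt vector with unit zeroth coordinate is a unit). [folklore] -/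
theorem isUnit_of_isUnit_teichSubP_mul_coeff_one {t : k} (ht : t ∈ maximalIdeal k) {w : WittVector p k}
    (h : IsUnit ((teichSubP p t * w).coeff 1)) : IsUnit w := by
  rw [coeff_one_teichSubP_mul] at h
  have hmem : w.coeff 1 * t ^ p ∈ maximalIdeal k := Ideal.mul_mem_left _ _ (Ideal.pow_mem_of_mem _ ht _ hp.out.pos)
  have h0 : IsUnit ((-1 : k) ^ p * w.coeff 0 ^ p) := by
    by_contra hnu
    exact (mem_maximalIdeal _).1 (Ideal.add_mem _ ((mem_maximalIdeal _).2 hnu) hmem) h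
  exact isUnit_of_isUnit_coeff_zero p ((isUnit_pow_iff hp.out.ne_zero).1 (IsUnit.mul_iff.1 h0).2)

/-- **An element of `𝕎(k)` with unit first coordinate that is divisible by `[t] − p`, `t ∈ 𝔪`, generates `([t] − p)`** — in particular
a primitive element of degree one lying in `𝔭 = ([t] − p)` generates `𝔭` (the uniqueness half of Lemma 6.2.2's «`𝔭 = 𝔭_1`»).
[claim: Joshi2023ATS2Local, status: disputed] -/
theorem span_eq_span_teichSubP_of_dvd {t : k} (ht : t ∈ maximalIdeal k) {x : WittVector p k} (hdvd : teichSubP p t ∣ x)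
    (h1 : IsUnit (x.coeff 1)) : Ideal.span {x} = Ideal.span {teichSubP p t} := by
  obtain ⟨w, rfl⟩ := hdvd
  exact Ideal.span_singleton_mul_right_unit (isUnit_of_isUnit_teichSubP_mul_coeff_one p ht h1) _

/-- **`([s] − p) ⊆ ([t] − p)` with `t ∈ 𝔪` forces equality** (the first coordinate of `[s] − p` is the unit `(−1)^p`): the ideals
`([a] − p)` of Prop. 6.2.1 (2) are pairwise INCOMPARABLE unless equal. [claim: Joshi2023ATS2Local, status: disputed] -/
theorem span_teichSubP_eq_of_le {s t : k} (ht : t ∈ maximalIdeal k)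
    (h : Ideal.span ({teichSubP p s} : Set (WittVector p k)) ≤ Ideal.span {teichSubP p t}) :
    Ideal.span ({teichSubP p s} : Set (WittVector p k)) = Ideal.span {teichSubP p t} :=
  span_eq_span_teichSubP_of_dvd p ht (Ideal.mem_span_singleton.1 (h (Ideal.mem_span_singleton_self _)))
    (by rw [coeff_one_teichSubP]; exact (isUnit_one.neg).pow p)

/-- … and then the parameters are associated: `s = t·u`, `u` a unit (`k` a domain). [folklore] -/
theorem exists_unit_of_span_teichSubP_le [IsDomain k] {s t : k} (ht : t ∈ maximalIdeal k)
    (h : Ideal.span ({teichSubP p s} : Set (WittVector p k)) ≤ Ideal.span {teichSubP p t}) : ∃ u : k, IsUnit u ∧ s = t * u :=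
  exists_unit_mul_of_span_teichSubP_eq p (span_teichSubP_eq_of_le p ht h)

/-- `𝔭_i(a) ⊆ 𝔭_j(b)` with `b ∈ 𝔪` forces `𝔭_i(a) = 𝔭_j(b)` (Prop. 6.2.1 (2)'s ideals, any two tuples). [claim: Joshi2023ATS2Local, status: disputed] -/
theorem jIdeal_eq_of_le {lstar : ℕ} {a b : k} (hb : b ∈ maximalIdeal k) {i j : Fin lstar}
    (h : jIdeal p lstar a i ≤ jIdeal p lstar b j) : jIdeal p lstar a i = jIdeal p lstar b j :=
  span_teichSubP_eq_of_le p (Ideal.pow_mem_of_mem _ hb _ (Nat.succ_le_of_lt (by positivity))) h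

/-- **Within one tuple the `ℓ⋆` ideals are pairwise incomparable**: `𝔭_i(a) ⊆ 𝔭_j(a) ↔ i = j` (`0 ≠ a ∈ 𝔪`, `k` a local domain;
with `Witt.jIdeal_injective`). [claim: Joshi2023ATS2Local, status: disputed] -/
theorem jIdeal_le_iff [IsDomain k] {lstar : ℕ} {a : k} (ha0 : a ≠ 0) (ha : a ∈ maximalIdeal k) {i j : Fin lstar} :
    jIdeal p lstar a i ≤ jIdeal p lstar a j ↔ i = j :=
  ⟨fun h => jIdeal_injective p (maximalIdeal.isMaximal k).ne_top ha0 ha lstar (jIdeal_eq_of_le p ha h), fun h => h ▸ le_rfl⟩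

/-- **Uniqueness in Lemma 6.2.2** (p. 15 l. 15–26): if an element `x` with unit first coordinate (e.g. primitive of degree one) is
divisible by `[a] − p` AND by `[b] − p`, `a, b ∈ 𝔪`, then `([a] − p) = ([b] − p)` — the `𝔭_1` (hence, by `Witt.exists_unit_mul_of_span_teichSubP_eq`,
the parameter up to a unit, and the whole tuple of ideals) is determined by `𝔭 = (x)`. [claim: Joshi2023ATS2Local, status: disputed] -/
theorem span_teichSubP_eq_of_dvd_of_dvd {a b : k} (ha : a ∈ maximalIdeal k) (hb : b ∈ maximalIdeal k) {x : WittVector p k}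
    (h1 : IsUnit (x.coeff 1)) (hax : teichSubP p a ∣ x) (hbx : teichSubP p b ∣ x) :
    Ideal.span ({teichSubP p a} : Set (WittVector p k)) = Ideal.span {teichSubP p b} := by
  rw [← span_eq_span_teichSubP_of_dvd p ha hax h1, span_eq_span_teichSubP_of_dvd p hb hbx h1]

end LocalCharP

/-! ## 2. The tilt of a local ring is local; `𝒪_{ℂ_F}` is local; `p♭ ∈ 𝔪_F` -/

section Tilt

variable (p : ℕ) [hp : Fact p.Prime] {O : Type*} [CommRing O] [Fact (¬ IsUnit (p : O))]

/-- **Units of the tilt**: `x ∈ 𝒪♭` is a unit iff its image `x₀ ∈ 𝒪/p` is (p442499's `preTilt_isUnit_of_isUnit_coeff_zero` + functoriality).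
[folklore] -/
theorem preTilt_isUnit_iff (x : PreTilt O p) : IsUnit x ↔ IsUnit (PreTilt.coeff 0 x) :=
  ⟨fun h => h.map _, preTilt_isUnit_of_isUnit_coeff_zero p⟩

/-- `𝒪/p` is a local ring when `𝒪` is (`p` a non-unit). [folklore] -/
theorem isLocalRing_modP [IsLocalRing O] : IsLocalRing (ModP O p) :=
  IsLocalRing.of_surjective' (Ideal.Quotient.mk _) Ideal.Quotient.mk_surjective

/-- **The tilt `𝒪♭ = PreTilt 𝒪 p` of a local ring `𝒪` is a local ring** (for `x ∈ 𝒪♭`, `x₀` or `1 − x₀` is a unit of the local ring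
`𝒪/p`, and units lift by `preTilt_isUnit_iff`). Stated as a THEOREM (no instance; use through `haveI`). [folklore] -/
theorem isLocalRing_preTilt [IsLocalRing O] : IsLocalRing (PreTilt O p) := by
  haveI := isLocalRing_modP p (O := O)
  haveI : Nontrivial (PreTilt O p) := (CharP.nontrivial_of_char_ne_one (R := PreTilt O p) hp.out.ne_one)
  refine IsLocalRing.of_isUnit_or_isUnit_one_sub_self fun x => ?_
  rcases IsLocalRing.isUnit_or_isUnit_one_sub_self (PreTilt.coeff 0 x) with h | h
  · exact Or.inl (preTilt_isUnit_of_isUnit_coeff_zero p h)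
  · refine Or.inr (preTilt_isUnit_of_isUnit_coeff_zero p ?_)
    rwa [map_sub, map_one]

/-- In the local ring `𝒪♭`, a non-unit lies in every maximal ideal (there is only one). [folklore] -/
theorem mem_of_isMaximal_of_not_isUnit [IsLocalRing O] {𝔪 : Ideal (PreTilt O p)} (h𝔪 : 𝔪.IsMaximal) {x : PreTilt O p}
    (hx : ¬ IsUnit x) : x ∈ 𝔪 := by
  haveI := isLocalRing_preTilt p (O := O)
  rw [IsLocalRing.eq_maximalIdeal h𝔪]
  exact (mem_maximalIdeal _).2 hx

end Tilt

section IntegerC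

open Literature.NumberTheory.PAdicHodge Literature.NumberTheory.GaloisRepresentations ValuativeRel

variable {F : Type} [Field F] [ValuativeRel F] [TopologicalSpace F] [IsNonarchimedeanLocalField F]

/-- An element of `𝒪_{ℂ_F}` of norm `1` is a unit of `𝒪_{ℂ_F}` (its inverse has norm `1`). [folklore] -/
theorem isUnit_integerC_of_norm_eq_one {a : integerC F} (ha : ‖(a : CompletedAlgClosure F)‖ = 1) : IsUnit a := by
  have ha0 : (a : CompletedAlgClosure F) ≠ 0 := fun h => by rw [h, norm_zero] at ha; exact zero_ne_one ha
  refine ⟨⟨a, ⟨(a : CompletedAlgClosure F)⁻¹, ?_⟩, Subtype.ext ?_, Subtype.ext ?_⟩, rfl⟩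
  · rw [mem_integerC_iff, norm_inv, ha, inv_one]
  · change (a : CompletedAlgClosure F) * (a : CompletedAlgClosure F)⁻¹ = 1
    rw [mul_inv_cancel₀ ha0]
  · change (a : CompletedAlgClosure F)⁻¹ * (a : CompletedAlgClosure F) = 1
    rw [inv_mul_cancel₀ ha0]

/-- **`𝒪_{ℂ_F}` (the closed unit ball of `ℂ_F`) is a local ring**: an element has norm `1` (a unit) or norm `< 1`, and then `1 − a` has
norm `1` (ultrametric inequality). THEOREM, not an instance. [folklore] -/
theorem isLocalRing_integerC : IsLocalRing (integerC F) := by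
  refine IsLocalRing.of_isUnit_or_isUnit_one_sub_self fun a => ?_
  by_cases ha : ‖(a : CompletedAlgClosure F)‖ = 1
  · exact Or.inl (isUnit_integerC_of_norm_eq_one ha)
  · have hlt : ‖(a : CompletedAlgClosure F)‖ < 1 := lt_of_le_of_ne a.2 ha
    refine Or.inr (isUnit_integerC_of_norm_eq_one ?_)
    have hne : ‖(1 : CompletedAlgClosure F)‖ ≠ ‖(-(a : CompletedAlgClosure F))‖ := by
      rw [norm_one, norm_neg]; exact hlt.ne'
    rw [AddSubgroupClass.coe_sub, OneMemClass.coe_one, sub_eq_add_neg, IsUltrametricDist.norm_add_eq_max_of_norm_ne_norm hne, norm_one,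
      norm_neg, max_eq_left hlt.le]

variable {p : ℕ} [hp : Fact p.Prime] [Fact (¬ IsUnit (p : integerC F))]

/-- **`𝒪_{ℂ_F}♭` is a local ring** — its maximal ideal is Joshi's `𝔪_F` (`F = ℂ_p♭`: p. 14 l. 47–53). THEOREM, not an instance. [folklore] -/
theorem isLocalRing_preTilt_integerC : IsLocalRing (PreTilt (integerC F) p) :=
  haveI := isLocalRing_integerC (F := F)
  isLocalRing_preTilt p

/-- **`p♭ ∈ 𝔪_F`**: `p♭` lies in the (unique) maximal ideal of `𝒪_{ℂ_F}♭` — stated for any maximal `𝔪`, which in the local ring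
`𝒪_{ℂ_F}♭` IS `𝔪_F` (p442499's `not_isUnit_pFlat`). [folklore] -/
theorem pFlat_mem_of_isMaximal {𝔪 : Ideal (PreTilt (integerC F) p)} (h𝔪 : 𝔪.IsMaximal) : (pFlat : PreTilt (integerC F) p) ∈ 𝔪 :=
  haveI := isLocalRing_integerC (F := F)
  mem_of_isMaximal_of_not_isUnit p h𝔪 not_isUnit_pFlat

/-- **§1 at the genuine object**: an element of `𝕎(𝒪_{ℂ_F}♭)` with unit first Witt coordinate divisible by `[t] − p` for a NON-UNIT `t`
of `𝒪_{ℂ_F}♭` (i.e. `t ∈ 𝔪_F`) generates `([t] − p)`; at `t = p♭` this is `𝔭_1(p♭) = ker θ` (p442499's `jIdeal_pFlat_zero_eq_ker`).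
[claim: Joshi2023ATS2Local, status: disputed] -/
theorem span_eq_jIdeal_pFlat_zero_of_dvd {lstar : ℕ} (hl : 0 < lstar) {x : Ainf (p := p) F} (hdvd : (xi : Ainf (p := p) F) ∣ x)
    (h1 : IsUnit (x.coeff 1)) : Ideal.span {x} = jIdeal p lstar (pFlat : PreTilt (integerC F) p) ⟨0, hl⟩ := by
  haveI := isLocalRing_preTilt_integerC (F := F) (p := p)
  rw [jIdeal, ansatzTuple_pFlat_zero hl, ← teichSubP_pFlat]
  exact span_eq_span_teichSubP_of_dvd p ((mem_maximalIdeal _).2 not_isUnit_pFlat) hdvd h1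

variable [CharZero F]

/-- `ξ = [p♭] − p` is primitive of degree one with respect to Joshi's `𝔪_F` ITSELF (any maximal ideal of `𝒪_{ℂ_F}♭`).
[claim: Joshi2023ATS2Local, status: disputed] -/
theorem isPrimitiveDegOne_xi_of_isMaximal {𝔪 : Ideal (PreTilt (integerC F) p)} (h𝔪 : 𝔪.IsMaximal) :
    IsPrimitiveDegOne p 𝔪 (xi : Ainf (p := p) F) :=
  isPrimitiveDegOne_xi 𝔪 (pFlat_mem_of_isMaximal h𝔪)

/-- The ansatz tuple of `a = p♭` lies in `Σ̃_F` for Joshi's `𝔪_F` itself (Def. 6.2.3 AS PRINTED, any maximal `𝔪` of `𝒪_{ℂ_F}♭`).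
[claim: Joshi2023ATS2Local, status: disputed] -/
theorem ansatzTuple_pFlat_mem_of_isMaximal {𝔪 : Ideal (PreTilt (integerC F) p)} (h𝔪 : 𝔪.IsMaximal) (lstar : ℕ) :
    ansatzTuple p lstar (pFlat : PreTilt (integerC F) p) ∈ primitiveAnsatzW p 𝔪 lstar :=
  ansatzTuple_pFlat_mem 𝔪 (pFlat_mem_of_isMaximal h𝔪) lstar

end IntegerC

end Summit.ABC.IUTFork.Joshi.Witt

end
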